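/-
Origin: expansion seat `prover-pub-hodgecm-mc-binder-1-g18-0`, handover #R125r2 2026-08-21T00:56:30Z md5 c4795ceb3a22 (220 l.; REPLACE of HodgeCM/Model/AdelicThetaDistributionMultPin.lean — PKG file now 6c4fb0000cee (227 l., incl. packager Origin header); body of record 1d104426c5bc (223 l.) → this; owner binder-1 #R125 (RUN 68); CHANGE = +1 import `HodgeCM.Model.ArchKTypeOfMultOneDatum` (#CA65, RUN 68) and the hypothesis `hrk : Module.rank ℂ ↥((pinDatumZero/One …).admFamilies (archOpZero/One …)) ≤ 1` STRUCK from both theorems, replaced by the TERM `rank_admFamilies_thetaDistDatumZeroOf/OneOf_le_one V c hGR hGR₀ hGR₁ hGR₂ hGR₃ η hη hηc h₁W A hV _ _ _` (carch #CA65); docstrings updated; ALL FOUR declaration NAMES PRESERVED (names 0 added / 0 removed / 0 renamed; signatures of the two theorems lose one binder); nothing imports the file; ROWDEPS: PKG #CA65 + PKG #R125 (both RUN 68) → {#R125r2}; DROP-ALONE (drop ⇒ PKG keeps r1); NAMES for audit: HodgeCM.Model.ThetaAdelicSide.clsU_mem_iSup_block_of_mem_holSat_pinZero · HodgeCM.Model.ThetaAdelicSide.clsU_mem_iSup_block_of_mem_holSat_pinOne;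 NAME LIST: HodgeCM.Model.ThetaAdelicSide.clsU_mem_iSup_block_of_mem_holSat_pinZero · HodgeCM.Model.ThetaAdelicSide.clsU_mem_iSup_block_of_mem_holSat_pinOne; all decls: HodgeCM.Model.ThetaAdelicSide.pinDatumZero (def) · HodgeCM.Model.ThetaAdelicSide.clsU_mem_iSup_block_of_mem_holSat_pinZero · HodgeCM.Model.ThetaAdelicSide.pinDatumOne (def) · HodgeCM.Model.ThetaAdelicSide.clsU_mem_iSup_block_of_mem_holSat_pinOne) (`HOME/mc/pub-hodgecm-mc-binder-1-g18/stage69/HodgeCM/Model/AdelicThetaDistributionMultPin.lean`, md5 c4795ceb3a22, 220 lines);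
landed by the gen-29 packager (p-g29) in gate run 69 REPLACES the earlier landed copy of `HodgeCM/Model/AdelicThetaDistributionMultPin.lean` (verbatim).
-/
/-
Copyright (c) 2026 the pub-hodgecm formalisation cell (harness21).  New file, not vendored.
Origin: session prover-pub-hodgecm-mc-binder-1-g18-0 (unit pub-hodgecm-mc-binder-1-g18, BINDER PROVER gen 18; `hfam` clause 2 for EVERY theta form
of slots 0/1 of the honest adelic side with the pin's archimedean inputs PLUGGED: carch #CA61 `harm_lineOmega_kG`/`harch_k_of_defType_tmulG`,
#CA62 `hd_lineOmega_kG`/`hCR_lineOmega_kG`, PKG `blockFamilyOfAt_degOnePDual_binvPi_one_ne_zero`, and — r2 — the (J4-mult1) RANK statement itself,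
KERNEL-PROVED by carch #CA63–#CA65 (`rank_admFamilies_thetaDistDatumZeroOf/OneOf_le_one`): NO archimedean hypothesis is left), 2026-08-21.
Intended final place: `HodgeCM/Model/AdelicThetaDistributionMultPin.lean` (NEW additive model-layer leaf; imports binder-1's
`HodgeCM.Model.AdelicThetaDistributionMultEnd` (#R124) and carch's `HodgeCM.Model.ArchKTypeOfDist` (#CA61) / `HodgeCM.Model.ArchKTypeOfDistHol`
(#CA62) / `HodgeCM.Model.ArchKTypeOfMultOneDatum` (#CA65); nothing imports it; drop alone).
-/
import Summits.HodgeConjecture.HodgeCM.Model.AdelicThetaDistributionMultEnd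
import Summits.HodgeConjecture.HodgeCM.Model.ArchKTypeOfDist
import Summits.HodgeConjecture.HodgeCM.Model.ArchKTypeOfDistHol_2
import Summits.HodgeConjecture.HodgeCM.Model.ArchKTypeOfMultOneDatum

set_option autoImplicit false

/-!
# `hfam` clause 2 at the pin: the honest side, slots 0 and 1, standard family `blockFamilyOfAt … (degOnePDual Empty) (binvPi 1)`

For `S := archSideOf V c hGR hGR₀ hGR₁ hGR₂ hGR₃ η hη hηc h₁W A` and the slot-`k` product Weil datum of #1250 at the STANDARD harmonic family
`Φarch := blockFamilyOfAt … eR eS (degOnePDual Empty) (binvPi 1)` (carch's (C-Kf∞) currency):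
* `pinDatumZero/One …` — `thetaDistDatumZeroOf/OneOf …` with `harm := harm_lineOmega_zero/oneG …` (#CA61, inputs `hemb`, the sign facts `h₁W`,
  the slot equivalences `eR eS`, the character identity `hχ`) and `hdef := harch_zero/one_of_defType_tmulG …` (#CA61, inputs the definite exponent
  table `a`/`hω` and the definite-type identity `hdefI`);
* **`clsU_mem_iSup_block_of_mem_holSat_pinZero/One`**: for weight functions `𝓕 ⊆ {charInv χ}`, EVERY `F ∈ S.holSat hV k Γ 𝓕` lies in `holSatU`
  and its tower class lies in `⨆_{χ, charInv χ ∈ 𝓕} block(Ω_k(χ))` — #R124 `clsU_mem_iSup_block_of_mem_holSat_archSideOf_zero/one_of_rank_le_one`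
  with (AN)/(REP′) `hd`/`hCR` DISCHARGED by #CA62 `hd_lineOmega_kG`/`hCR_lineOmega_kG`, `Φarch ≠ 0` by PKG
  `ArchSideTerm.blockFamilyOfAt_degOnePDual_binvPi_one_ne_zero`, `har` by #CA27 (inside #R124), `hGfin`/`hLF` as in #1251, and the (J4-mult1)
  RANK input `Module.rank ℂ ↥((pinDatumZero/One …).admFamilies (archOpZero/One …)) ≤ 1` by carch #CA65
  `rank_admFamilies_thetaDistDatumZeroOf/OneOf_le_one` (KERNEL: the 9-torus / Hermite-line argument of #CA63–#CA64); hypotheses LEFT: the pin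
  data above, `hι`, `h𝓕` — nothing archimedean, nothing cited.
KERNEL only: two data `def`s (terms of the #1246 structure), 0 records, 0 `def … : Prop`, nothing cited; `#print axioms` ⊆ {propext, Classical.choice,
Quot.sound}.
-/

noncomputable section

open NumberField hiding relNormOneIdeles relNormOneRat probHaarRelNormOneQuot
open _root_.NumberField.InfinitePlace _root_.NumberField.mixedEmbedding MeasureTheory MulAction IsDedekindDomain
open scoped Matrix TensorProduct Classical SchwartzMap
open Literature.Geometry.ComplexHyperbolic.BallModel (U21 x₀ stabilizerEquivK21)
open Literature.NumberTheory.Automorphic.U21 (K21 matA sclD)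
open Literature.NumberTheory.Automorphic Literature.NumberTheory.Automorphic.UnitaryGroup Literature.NumberTheory.Weil1964
open Literature.NumberTheory.GelbartRogawski1991 Literature.NumberTheory.GelbartRogawski1991.UnitaryDualPair
open Literature.AlgebraicGeometry.HodgeTheory Literature.AlgebraicGeometry.ShimuraVarieties Literature.AlgebraicGeometry.ShimuraVarieties.BallForms
open Literature.NumberTheory.Automorphic.PicardCM
open Literature.NumberTheory.Transcendental (Arapura2012_Cor_15_4_6)
open Literature.Analysis.SegalBargmann
open HodgeCM.Adelic HodgeCM.PerL34 HodgeCM.Model.HypCensus HodgeCM.Model.ArchSideTerm HodgeCM.Model.ThetaDistFin HodgeCM.Model.TowerCarrier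
open HodgeCM.Model.SupplyInstance HodgeCM.Model.SupplyResidual HodgeCM.Model.ThetaSpace
open HodgeCM.Model.SupplyResidual.WeilPairData (charInv)

namespace HodgeCM.Model
namespace ThetaAdelicSide

variable (hHD : exists_isReal_hodgeModel) (hI : hodgePQ_independent_of_hodgeModel)
  (h₁ : BallQuotientUniformised) (h₃ : CMAbelianVarietyRealised) (hA : Arapura2012_Cor_15_4_6)
variable {L : CMField} {ι₁ : L →+* ℂ} (V : HermSpace3 L ι₁) (c : SeesawCtx L)
  (hGR : (cmSplittingDatum (L : Type) finProdFinEquiv (frameD V) (frameD_real V) (frameD_ne V) (dW c.D) (dW_real c.D)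
    (dW_ne c.D)).CompatibleSplitting)
  (hGR₀ : (cmSplittingDatum (L : Type) (e₁) (frameD V) (frameD_real V) (frameD_ne V) (lineVec (L : Type) (dW c.D 0))
    (fun _ => dW_real c.D 0) (fun _ => dW_ne c.D 0)).CompatibleSplitting)
  (hGR₁ : (cmSplittingDatum (L : Type) (e₁) (frameD V) (frameD_real V) (frameD_ne V) (lineVec (L : Type) (dW c.D 1))
    (fun _ => dW_real c.D 1) (fun _ => dW_ne c.D 1)).CompatibleSplitting)
  (hGR₂ : (cmSplittingDatum (L : Type) (e₁) (frameD V) (frameD_real V) (frameD_ne V) (lineVec (L : Type) (dW' c.D 0))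
    (fun _ => dW'_real c.D 0) (fun _ => dW'_ne c.D 0)).CompatibleSplitting)
  (hGR₃ : (cmSplittingDatum (L : Type) (e₁) (frameD V) (frameD_real V) (frameD_ne V) (lineVec (L : Type) (dW' c.D 1))
    (fun _ => dW'_real c.D 1) (fun _ => dW'_ne c.D 1)).CompatibleSplitting)
  (η : CMAdelic (L : Type) (frameD V) × CMAdelic (L : Type) (dW c.D) →* ℂˣ)
  (hη : ∀ γU ∈ CMRat (L : Type) (frameD V), ∀ γ ∈ CMRat (L : Type) (dW c.D), η (γU, γ) = 1)
  (hηc : Continuous fun p => ((η p : ℂˣ) : ℂ))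
  (h₁W : (∀ j, 0 < (ι₁ (dW c.D j)).re) ∨ ∀ j, (ι₁ (dW c.D j)).re < 0)
  (A : ∀ k : Fin 4, ArchLineInput V (lineRepD V c.D hGR hGR₀ hGR₁ hGR₂ hGR₃ η k))
  (hV : IsAnisotropic L V.Hm)
  (hemb : (InfinitePlace.mk ι₁).embedding = ι₁)

/-! ### § 1. Slot 0 -/

section Zero

variable
  (eR : PosIdx (cmXW (L : Type) (frameD V) (lineVec (L : Type) (dW c.D 0)) (fun _ => dW_real c.D 0) ι₁ (HypCensus.cmPlace (L : Type) ι₁)) ≃ Unit)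
  (eS : NegIdx (cmXW (L : Type) (frameD V) (lineVec (L : Type) (dW c.D 0)) (fun _ => dW_real c.D 0) ι₁ (HypCensus.cmPlace (L : Type) ι₁)) ≃ Empty)
  (hχ : ∀ u : stabilizer U21 x₀,
    ((lineScalar_zero V c.D hGR hGR₀ hGR₁ (eta₀ V c.D η) (u : U21) : ℂˣ) : ℂ) *
        ((matA (stabilizerEquivK21.symm u)).det ^ (lineVacExponentsZero V c hGR₀ h₁W eR eS).eP *
          sclD (stabilizerEquivK21.symm u) ^ (lineVacExponentsZero V c hGR₀ h₁W eR eS).eQ) =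
      star (sclD (stabilizerEquivK21.symm u)))
  (a : {v : InfinitePlace ↥(maximalRealSubfield L) // v.IsReal} → ℤ)
  (hω : ∀ b : {v : InfinitePlace ↥(maximalRealSubfield L) // v.IsReal}, b ≠ HypCensus.cmPlace (L : Type) ι₁ →
    ∀ (u : UnitaryGroup.archLocal (L : Type) 3 (Matrix.diagonal (frameD V)) (cmPlaceOver (L : Type) b)) (ℓ : Module.Dual ℂ (Fin 2 → ℂ)),
      cmArchWeilRep (L : Type) e₁ (frameD V) (frameD_real V) (frameD_ne V) (lineVec (L : Type) (dW c.D 0)) (fun _ => dW_real c.D 0)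
          (fun _ => dW_ne c.D 0) hGR₀
          (UnitaryGroup.archSingle (↥(maximalRealSubfield L)) L (IsCMField.complexConj L) 3 (Matrix.diagonal (frameD V))
            (IsCMField.complexConj_ne_one L) (NumberField.complexConj_smul_infinitePlace (L : Type)) (cmPlaceOver (L : Type) b) u, 1)
          (blockFamilyOfAt (L : Type) e₁ (frameD V) (frameD_real V) (frameD_ne V) (lineVec (L : Type) (dW c.D 0)) (fun _ => dW_real c.D 0)
            (fun _ => dW_ne c.D 0) ι₁ (blockPosEquiv V) (blockNegEquiv V) eR eS (degOnePDual Empty) (binvPi 1) ℓ) =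
        (((u : UnitaryGroup.archLocal (L : Type) 3 (Matrix.diagonal (frameD V)) (cmPlaceOver (L : Type) b)) : GL (Fin 3) ℂ) :
            Matrix (Fin 3) (Fin 3) ℂ).det ^ a b •
          blockFamilyOfAt (L : Type) e₁ (frameD V) (frameD_real V) (frameD_ne V) (lineVec (L : Type) (dW c.D 0)) (fun _ => dW_real c.D 0)
            (fun _ => dW_ne c.D 0) ι₁ (blockPosEquiv V) (blockNegEquiv V) eR eS (degOnePDual Empty) (binvPi 1) ℓ)
  (hdefI : ∀ b : {v : InfinitePlace ↥(maximalRealSubfield L) // v.IsReal}, b ≠ HypCensus.cmPlace (L : Type) ι₁ →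
    ∀ u : UnitaryGroup.archLocal (L : Type) 3 (Matrix.diagonal (frameD V)) (cmPlaceOver (L : Type) b),
      ((archScalar_zeroG V c.D hGR hGR₀ hGR₁ (eta₀ V c.D η)
          (UnitaryGroup.archSingle (↥(maximalRealSubfield L)) L (IsCMField.complexConj L) 3 (Matrix.diagonal (frameD V))
            (IsCMField.complexConj_ne_one L) (NumberField.complexConj_smul_infinitePlace (L : Type)) (cmPlaceOver (L : Type) b) u) : ℂˣ) : ℂ) *
        (((u : UnitaryGroup.archLocal (L : Type) 3 (Matrix.diagonal (frameD V)) (cmPlaceOver (L : Type) b)) : GL (Fin 3) ℂ) :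
            Matrix (Fin 3) (Fin 3) ℂ).det ^ a b = 1)

/-- **The slot-0 product Weil datum AT THE PIN**: #1250 `thetaDistDatumZeroOf …` at the standard harmonic family
`blockFamilyOfAt … eR eS (degOnePDual Empty) (binvPi 1)`, with `harm`/`hdef` supplied by carch #CA61. -/
def pinDatumZero : ThetaDistDatum (archSideOf V c hGR hGR₀ hGR₁ hGR₂ hGR₃ η hη hηc h₁W A) hV 0 :=
  thetaDistDatumZeroOf V c hGR hGR₀ hGR₁ hGR₂ hGR₃ η hη hηc h₁W A hV
    (blockFamilyOfAt (L : Type) e₁ (frameD V) (frameD_real V) (frameD_ne V) (lineVec (L : Type) (dW c.D 0)) (fun _ => dW_real c.D 0)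
      (fun _ => dW_ne c.D 0) ι₁ (blockPosEquiv V) (blockNegEquiv V) eR eS (degOnePDual Empty) (binvPi 1))
    (harm_lineOmega_zeroG V c hGR hGR₀ hGR₁ (eta₀ V c.D η) h₁W (binvPi 1) hemb eR eS hχ)
    (harch_zero_of_defType_tmulG V c.D hGR hGR₀ hGR₁ hGR₂ hGR₃ (eta₀ V c.D η) (eta₁ V c.D η) (eta₂ V c.D η) (eta₃ V c.D η) hV eR eS a hω hdefI)

/-- **`hfam` clause 2 at the pin, slot 0 — NO archimedean hypothesis**: EVERY saturated hol-germ theta form `F ∈ holSat Γ 𝓕` of slot 0 of the honest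
side (`𝓕 ⊆ {charInv χ}`) lies in `holSatU` and has its tower class in `⨆_{χ, charInv χ ∈ 𝓕} block(Ω₀(χ))` ((J4-mult1) supplied by carch #CA65). -/
theorem clsU_mem_iSup_block_of_mem_holSat_pinZero
    {𝓕 : Set C(↥(relNormOneIdeles (↥(maximalRealSubfield L)) L) ⧸ relNormOneRat (↥(maximalRealSubfield L)) L, ℂ)}
    (h𝓕 : ∀ f ∈ 𝓕, ∃ χ : PontryaginDual (↥(relNormOneIdeles (↥(maximalRealSubfield L)) L) ⧸ relNormOneRat (↥(maximalRealSubfield L)) L),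
      f = charInv χ)
    (hι : (archSideOf V c hGR hGR₀ hGR₁ hGR₂ hGR₃ η hη hηc h₁W A).ιinf = archInfOf V) (Γ : Level V)
    {F : (V.latticeModel printFact_unitaryCompact_holds).G → (Fin 2 → ℂ)}
    (hF : F ∈ (archSideOf V c hGR hGR₀ hGR₁ hGR₂ hGR₃ η hη hηc h₁W A).holSat hV 0 Γ 𝓕) :
    ∃ hF' : F ∈ (archSideOf V c hGR hGR₀ hGR₁ hGR₂ hGR₃ η hη hηc h₁W A).holSatU hV 0 𝓕,
      (archSideOf V c hGR hGR₀ hGR₁ hGR₂ hGR₃ η hη hηc h₁W A).clsU hHD hI h₁ h₃ hA 𝓕 hι hV 0 ⟨F, hF'⟩ ∈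
        ⨆ (χ : PontryaginDual (↥(relNormOneIdeles (↥(maximalRealSubfield L)) L) ⧸ relNormOneRat (↥(maximalRealSubfield L)) L))
          (_ : charInv χ ∈ 𝓕),
          ⨆ ψ : ((pinDatumZero V c hGR hGR₀ hGR₁ hGR₂ hGR₃ η hη hηc h₁W A hV hemb eR eS hχ a hω hdefI).coinvRep χ).asModule
              →ₗ[MonoidAlgebra ℂ ↥V.adelicFin] Tower hHD hI (ballQuotientUniformisedDatum_of h₁) h₃ hA V,
            (LinearMap.range ψ).restrictScalars ℂ :=
  clsU_mem_iSup_block_of_mem_holSat_archSideOf_zero_of_rank_le_one hHD hI h₁ h₃ hA V c hGR hGR₀ hGR₁ hGR₂ hGR₃ η hη hηc h₁W A hV _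
    (harm_lineOmega_zeroG V c hGR hGR₀ hGR₁ (eta₀ V c.D η) h₁W (binvPi 1) hemb eR eS hχ)
    (harch_zero_of_defType_tmulG V c.D hGR hGR₀ hGR₁ hGR₂ hGR₃ (eta₀ V c.D η) (eta₁ V c.D η) (eta₂ V c.D η) (eta₃ V c.D η) hV eR eS a hω hdefI)
    (hd_lineOmega_zeroG V c hGR hGR₀ hGR₁ (eta₀ V c.D η) h₁W (binvPi 1) eR eS hemb)
    (hCR_lineOmega_zeroG V c hGR hGR₀ hGR₁ (eta₀ V c.D η) h₁W (binvPi 1) eR eS hemb) h𝓕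
    (fun h => ArchSideTerm.blockFamilyOfAt_degOnePDual_binvPi_one_ne_zero Empty (L : Type) e₁ (frameD V) (frameD_real V) (frameD_ne V)
      (lineVec (L : Type) (dW c.D 0)) (fun _ => dW_real c.D 0) (fun _ => dW_ne c.D 0) ι₁ (blockPosEquiv V) (blockNegEquiv V) eR eS
      (by rw [h]; rfl))
    (rank_admFamilies_thetaDistDatumZeroOf_le_one V c hGR hGR₀ hGR₁ hGR₂ hGR₃ η hη hηc h₁W A hV _ _ _) hι Γ hF

end Zero

/-! ### § 2. Slot 1 -/

section One

variable
  (eR : PosIdx (cmXW (L : Type) (frameD V) (lineVec (L : Type) (dW c.D 1)) (fun _ => dW_real c.D 1) ι₁ (HypCensus.cmPlace (L : Type) ι₁)) ≃ Unit)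
  (eS : NegIdx (cmXW (L : Type) (frameD V) (lineVec (L : Type) (dW c.D 1)) (fun _ => dW_real c.D 1) ι₁ (HypCensus.cmPlace (L : Type) ι₁)) ≃ Empty)
  (hχ : ∀ u : stabilizer U21 x₀,
    ((lineScalar_one V c.D hGR hGR₀ hGR₁ (eta₁ V c.D η) (u : U21) : ℂˣ) : ℂ) *
        ((matA (stabilizerEquivK21.symm u)).det ^ (lineVacExponentsOne V c hGR₁ h₁W eR eS).eP *
          sclD (stabilizerEquivK21.symm u) ^ (lineVacExponentsOne V c hGR₁ h₁W eR eS).eQ) =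
      star (sclD (stabilizerEquivK21.symm u)))
  (a : {v : InfinitePlace ↥(maximalRealSubfield L) // v.IsReal} → ℤ)
  (hω : ∀ b : {v : InfinitePlace ↥(maximalRealSubfield L) // v.IsReal}, b ≠ HypCensus.cmPlace (L : Type) ι₁ →
    ∀ (u : UnitaryGroup.archLocal (L : Type) 3 (Matrix.diagonal (frameD V)) (cmPlaceOver (L : Type) b)) (ℓ : Module.Dual ℂ (Fin 2 → ℂ)),
      cmArchWeilRep (L : Type) e₁ (frameD V) (frameD_real V) (frameD_ne V) (lineVec (L : Type) (dW c.D 1)) (fun _ => dW_real c.D 1)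
          (fun _ => dW_ne c.D 1) hGR₁
          (UnitaryGroup.archSingle (↥(maximalRealSubfield L)) L (IsCMField.complexConj L) 3 (Matrix.diagonal (frameD V))
            (IsCMField.complexConj_ne_one L) (NumberField.complexConj_smul_infinitePlace (L : Type)) (cmPlaceOver (L : Type) b) u, 1)
          (blockFamilyOfAt (L : Type) e₁ (frameD V) (frameD_real V) (frameD_ne V) (lineVec (L : Type) (dW c.D 1)) (fun _ => dW_real c.D 1)
            (fun _ => dW_ne c.D 1) ι₁ (blockPosEquiv V) (blockNegEquiv V) eR eS (degOnePDual Empty) (binvPi 1) ℓ) =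
        (((u : UnitaryGroup.archLocal (L : Type) 3 (Matrix.diagonal (frameD V)) (cmPlaceOver (L : Type) b)) : GL (Fin 3) ℂ) :
            Matrix (Fin 3) (Fin 3) ℂ).det ^ a b •
          blockFamilyOfAt (L : Type) e₁ (frameD V) (frameD_real V) (frameD_ne V) (lineVec (L : Type) (dW c.D 1)) (fun _ => dW_real c.D 1)
            (fun _ => dW_ne c.D 1) ι₁ (blockPosEquiv V) (blockNegEquiv V) eR eS (degOnePDual Empty) (binvPi 1) ℓ)
  (hdefI : ∀ b : {v : InfinitePlace ↥(maximalRealSubfield L) // v.IsReal}, b ≠ HypCensus.cmPlace (L : Type) ι₁ →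
    ∀ u : UnitaryGroup.archLocal (L : Type) 3 (Matrix.diagonal (frameD V)) (cmPlaceOver (L : Type) b),
      ((archScalar_oneG V c.D hGR hGR₀ hGR₁ (eta₁ V c.D η)
          (UnitaryGroup.archSingle (↥(maximalRealSubfield L)) L (IsCMField.complexConj L) 3 (Matrix.diagonal (frameD V))
            (IsCMField.complexConj_ne_one L) (NumberField.complexConj_smul_infinitePlace (L : Type)) (cmPlaceOver (L : Type) b) u) : ℂˣ) : ℂ) *
        (((u : UnitaryGroup.archLocal (L : Type) 3 (Matrix.diagonal (frameD V)) (cmPlaceOver (L : Type) b)) : GL (Fin 3) ℂ) :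
            Matrix (Fin 3) (Fin 3) ℂ).det ^ a b = 1)

/-- **The slot-1 product Weil datum AT THE PIN**: #1250 `thetaDistDatumOneOf …` at the standard harmonic family
`blockFamilyOfAt … eR eS (degOnePDual Empty) (binvPi 1)`, with `harm`/`hdef` supplied by carch #CA61. -/
def pinDatumOne : ThetaDistDatum (archSideOf V c hGR hGR₀ hGR₁ hGR₂ hGR₃ η hη hηc h₁W A) hV 1 :=
  thetaDistDatumOneOf V c hGR hGR₀ hGR₁ hGR₂ hGR₃ η hη hηc h₁W A hV
    (blockFamilyOfAt (L : Type) e₁ (frameD V) (frameD_real V) (frameD_ne V) (lineVec (L : Type) (dW c.D 1)) (fun _ => dW_real c.D 1)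
      (fun _ => dW_ne c.D 1) ι₁ (blockPosEquiv V) (blockNegEquiv V) eR eS (degOnePDual Empty) (binvPi 1))
    (harm_lineOmega_oneG V c hGR hGR₀ hGR₁ (eta₁ V c.D η) h₁W (binvPi 1) hemb eR eS hχ)
    (harch_one_of_defType_tmulG V c.D hGR hGR₀ hGR₁ hGR₂ hGR₃ (eta₀ V c.D η) (eta₁ V c.D η) (eta₂ V c.D η) (eta₃ V c.D η) hV eR eS a hω hdefI)

/-- **`hfam` clause 2 at the pin, slot 1 — NO archimedean hypothesis** ((J4-mult1) supplied by carch #CA65). -/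
theorem clsU_mem_iSup_block_of_mem_holSat_pinOne
    {𝓕 : Set C(↥(relNormOneIdeles (↥(maximalRealSubfield L)) L) ⧸ relNormOneRat (↥(maximalRealSubfield L)) L, ℂ)}
    (h𝓕 : ∀ f ∈ 𝓕, ∃ χ : PontryaginDual (↥(relNormOneIdeles (↥(maximalRealSubfield L)) L) ⧸ relNormOneRat (↥(maximalRealSubfield L)) L),
      f = charInv χ)
    (hι : (archSideOf V c hGR hGR₀ hGR₁ hGR₂ hGR₃ η hη hηc h₁W A).ιinf = archInfOf V) (Γ : Level V)
    {F : (V.latticeModel printFact_unitaryCompact_holds).G → (Fin 2 → ℂ)}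
    (hF : F ∈ (archSideOf V c hGR hGR₀ hGR₁ hGR₂ hGR₃ η hη hηc h₁W A).holSat hV 1 Γ 𝓕) :
    ∃ hF' : F ∈ (archSideOf V c hGR hGR₀ hGR₁ hGR₂ hGR₃ η hη hηc h₁W A).holSatU hV 1 𝓕,
      (archSideOf V c hGR hGR₀ hGR₁ hGR₂ hGR₃ η hη hηc h₁W A).clsU hHD hI h₁ h₃ hA 𝓕 hι hV 1 ⟨F, hF'⟩ ∈
        ⨆ (χ : PontryaginDual (↥(relNormOneIdeles (↥(maximalRealSubfield L)) L) ⧸ relNormOneRat (↥(maximalRealSubfield L)) L))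
          (_ : charInv χ ∈ 𝓕),
          ⨆ ψ : ((pinDatumOne V c hGR hGR₀ hGR₁ hGR₂ hGR₃ η hη hηc h₁W A hV hemb eR eS hχ a hω hdefI).coinvRep χ).asModule
              →ₗ[MonoidAlgebra ℂ ↥V.adelicFin] Tower hHD hI (ballQuotientUniformisedDatum_of h₁) h₃ hA V,
            (LinearMap.range ψ).restrictScalars ℂ :=
  clsU_mem_iSup_block_of_mem_holSat_archSideOf_one_of_rank_le_one hHD hI h₁ h₃ hA V c hGR hGR₀ hGR₁ hGR₂ hGR₃ η hη hηc h₁W A hV _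
    (harm_lineOmega_oneG V c hGR hGR₀ hGR₁ (eta₁ V c.D η) h₁W (binvPi 1) hemb eR eS hχ)
    (harch_one_of_defType_tmulG V c.D hGR hGR₀ hGR₁ hGR₂ hGR₃ (eta₀ V c.D η) (eta₁ V c.D η) (eta₂ V c.D η) (eta₃ V c.D η) hV eR eS a hω hdefI)
    (hd_lineOmega_oneG V c hGR hGR₀ hGR₁ (eta₁ V c.D η) h₁W (binvPi 1) eR eS hemb)
    (hCR_lineOmega_oneG V c hGR hGR₀ hGR₁ (eta₁ V c.D η) h₁W (binvPi 1) eR eS hemb) h𝓕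
    (fun h => ArchSideTerm.blockFamilyOfAt_degOnePDual_binvPi_one_ne_zero Empty (L : Type) e₁ (frameD V) (frameD_real V) (frameD_ne V)
      (lineVec (L : Type) (dW c.D 1)) (fun _ => dW_real c.D 1) (fun _ => dW_ne c.D 1) ι₁ (blockPosEquiv V) (blockNegEquiv V) eR eS
      (by rw [h]; rfl))
    (rank_admFamilies_thetaDistDatumOneOf_le_one V c hGR hGR₀ hGR₁ hGR₂ hGR₃ η hη hηc h₁W A hV _ _ _) hι Γ hF

end One

end ThetaAdelicSide
end HodgeCM.Model

end
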